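import Summits.RiemannHypothesis.RiemannHypothesis.Theorems.PfPersistenceEdgeLawCutArchBound
import Summits.RiemannHypothesis.RiemannHypothesis.Theorems.WeilWindowFlowWindowLipschitz

/-!
# Edge law by cutting — the energy bound of the steep cut and its error scaling (RH-free)

Part of the pub-rhpf THEORY-2 programme (mechanism / rigidity of the Weil window bottom; no RH
claims). For a normalised Weil ground state `u` of the window `a` (measurable, zero off `(−a, a)`,
bounded by `K`, pointwise edge law with constant `K_P` at depth `< d₀`, cumulative edge masses
`m(r) ≤ I′ r/log(1/r)` on `(0, r₀]`) the localisation inequality (D) of the `WindowLipschitz`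
line (`stub_localizedCut`, fed with the landed (C1), (C2), (EL)), applied at the window `a − h`
to the steep cutoff `χ = steepCut (a − h) ℓ`, gives

`(ε(a − h) − ε(a)) · (1 − I′H/log(1/H)) ≤ θ · I′ · H + cutArchErr + cutPrimePoleErr`

(`H = h + ℓ`, `θ = R/(R − H)`; `cut_energy_bound`): the archimedean commutator is
`cut_arch_bound`, the prime commutators and the cut pole pairings are `O(H/√log(1/H))` through
the `L¹` norm of `u` on the edge layer (`cut_layer_norm_le`), and `‖χu‖² ≥ 1 − m(H)`.
Along the scaling `ℓ = ηh`, `R = κh` (`κ ≥ 2(1 + η)`, `r₀` fixed) the two error terms are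
`≤ C · h/√log(1/(κh))` with an explicit constant (`cutErr_le`), hence `o(h)`; two elementary
lemmas for the limit (`le_log_one_div_of_le_exp_neg`, `edgeUpper_of_massDefect`).

Sources: E. Bombieri, *Remarks on Weil's quadratic functional in the theory of prime numbers I*,
Rend. Mat. Acc. Lincei (9) 11 (2000) §4–§6; Cycon–Froese–Kirsch–Simon, *Schrödinger Operators*,
Thm 3.2 (IMS localisation).
-/

set_option linter.dupNamespace false

noncomputable section

open MeasureTheory Set Filter
open scoped Topology ENNReal NNReal

namespace Summit.RiemannHypothesis.RiemannHypothesis.Theorems.PfPersistence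

open Literature.NumberTheory.LFunctions
open Summit.RiemannHypothesis.RiemannHypothesis.Theorems.WeilWindowFlowWindowLipschitz

/-- The prime-and-pole error of the cut bound: with `B_F = (1 + I′/2) H/√log(1/H)` (`H = h + ℓ`,
the bound of the layer `L¹` norm), `M = cosh(a/2)` and `S_a = Σ_{log n < 2a} Λ(n) n^{-1/2}`, it is
`(2 K S_a + 4 M² (a + 1/2) + 2 M² B_F) · B_F`. -/
def cutPrimePoleErr (a h ℓ K I' : ℝ) : ℝ :=
  (2 * K * (∑ n ∈ weilPrimeIndex a, (ArithmeticFunction.vonMangoldt n : ℝ) / Real.sqrt n) +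
      4 * Real.cosh (a / 2) ^ 2 * (a + 1 / 2) +
      2 * Real.cosh (a / 2) ^ 2 *
        ((1 + I' / 2) * (h + ℓ) / Real.sqrt (Real.log (1 / (h + ℓ))))) *
    ((1 + I' / 2) * (h + ℓ) / Real.sqrt (Real.log (1 / (h + ℓ))))

set_option maxHeartbeats 800000 in
/-- **The energy bound of the steep cut.** See the module docstring. -/
theorem cut_energy_bound {u : ℝ → ℂ} {a h ℓ R r₀ d₀ K KP I' : ℝ} (hum : Measurable u)
    (hu : IsWeilGroundState a u) (hu0 : ∀ x, x ∉ Ioo (-a) a → u x = 0) (hK : ∀ x, ‖u x‖ ≤ K)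
    (hP : ∀ x, 0 < a - |x| → a - |x| < d₀ → ‖u x‖ ^ 2 * Real.log (1 / (a - |x|)) ≤ KP)
    (hB : ∀ r, 0 < r → r ≤ r₀ →
      ∫ x in {x : ℝ | a - r < |x|}, ‖u x‖ ^ 2 ≤ I' * r / Real.log (1 / r))
    (hh : 0 < h) (hℓ : 0 < ℓ) (hHR : 2 * (h + ℓ) ≤ R) (hRr : R ≤ r₀) (hrd : r₀ ≤ d₀) (hd1 : d₀ < 1)
    (hra : 2 * r₀ ≤ a) (hKP : 0 ≤ KP) (hI : 0 ≤ I') :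
    (weilGroundEnergy (a - h) - weilGroundEnergy a) *
        (1 - I' * (h + ℓ) / Real.log (1 / (h + ℓ))) ≤
      R / (R - (h + ℓ)) * I' * (h + ℓ) + cutArchErr a h ℓ R r₀ KP I' +
        cutPrimePoleErr a h ℓ K I' := by
  unfold cutPrimePoleErr
  -- parameters
  have hH : 0 < h + ℓ := by positivity
  have hH1 : h + ℓ < 1 := by linarith
  have ha : 0 < a := hu.pos
  have hb : 0 < a - h := by linarith
  have hba : a - h ≤ a := by linarith
  have hLH : 0 < Real.log (1 / (h + ℓ)) := stub_surplusReduction_log_pos hH hH1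
  set sH := Real.sqrt (Real.log (1 / (h + ℓ))) with hsHdef
  have hsH : 0 < sH := Real.sqrt_pos.2 hLH
  set BF : ℝ := (1 + I' / 2) * (h + ℓ) / sH with hBFdef
  have hBF0 : 0 ≤ BF := by positivity
  set M := Real.cosh (a / 2) with hMdef
  have hM : 0 ≤ M := (Real.cosh_pos _).le
  set Sa := ∑ n ∈ weilPrimeIndex a, (ArithmeticFunction.vonMangoldt n : ℝ) / Real.sqrt n
    with hSadef
  -- data on `u`
  have hKnn : 0 ≤ K := (norm_nonneg _).trans (hK 0)
  have hu0' : ∀ x, x ∉ Icc (-a) a → u x = 0 :=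
    fun x hx ↦ hu0 x fun h' ↦ hx (Ioo_subset_Icc_self h')
  have hui : Integrable u := hu.integrable
  have hu2 : Integrable fun x ↦ ‖u x‖ ^ 2 :=
    (memLp_two_iff_integrable_sq_norm hu.memLp.1).1 hu.memLp
  have hnorm : ∫ x, ‖u x‖ ^ 2 = 1 := hu.integral_norm_sq
  have hL1 : ∫ x, ‖u x‖ ≤ a + 1 / 2 := by
    have := stub_commutatorBound_norm_one_le ha.le hu0' hu2
    rw [hnorm] at this
    linarith
  have hmH : ∫ x in {x : ℝ | a - (h + ℓ) < |x|}, ‖u x‖ ^ 2 ≤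
      I' * (h + ℓ) / Real.log (1 / (h + ℓ)) := hB (h + ℓ) hH (by linarith)
  -- the cutoff `χ = steepCut (a − h) ℓ`
  have hχ01 : ∀ x, 0 ≤ steepCut (a - h) ℓ x ∧ steepCut (a - h) ℓ x ≤ 1 :=
    fun x ↦ steepCut_mem _ _ _
  have hχ0 : ∀ x, a - h ≤ |x| → steepCut (a - h) ℓ x = 0 := fun x hx ↦ steepCut_eq_zero hℓ hx
  have hχ1 : ∀ x, |x| ≤ a - 2 * ((h + ℓ) / 2) → steepCut (a - h) ℓ x = 1 :=
    fun x hx ↦ steepCut_eq_one hℓ (by linarith)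
  -- the localisation inequality (D) at the window `a − h`
  have hD := stub_localizedCut stub_formDomainPos stub_groundStateEnergy
    (stub_eulerLagrange stub_formDomainPos stub_groundStateEnergy) a (a - h)
    (Real.toNNReal (1 / ℓ)) u (steepCut (a - h) ℓ) hb hba hu (lipschitzWith_steepCut hℓ) hχ01 hχ0
  -- the layer majorant `f`
  set Lay : Set ℝ := {y : ℝ | a - (h + ℓ) < |y|} with hLaydef
  have hLaym : MeasurableSet Lay := stub_commutatorBound_measurableSet_layer a (h + ℓ)
  set f : ℝ → ℝ := Lay.indicator (fun y ↦ ‖u y‖) with hfdef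
  have hf0 : ∀ x, 0 ≤ f x := fun x ↦ indicator_nonneg (fun _ _ ↦ norm_nonneg _) x
  have hfb : ∀ y, a - |y| < 2 * ((h + ℓ) / 2) → ‖u y‖ ≤ f y := fun y hy ↦ by
    rw [hfdef, indicator_of_mem (show y ∈ Lay by rw [hLaydef, mem_setOf_eq]; linarith)]
  have hfi : Integrable f := hui.norm.indicator hLaym
  have hintf : ∫ x, f x ≤ BF := by
    rw [hfdef, integral_indicator hLaym]
    exact cut_layer_norm_le hu2 hu0 hH hH1 hmH
  -- (1) the archimedean commutator
  have hT1 := cut_arch_bound hum hu hu0 hP hB hh hℓ hHR hRr hrd hd1 hra hKP hI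
  -- (2) the prime commutators
  have hT2 : ∑ n ∈ weilPrimeIndex a, (ArithmeticFunction.vonMangoldt n : ℝ) / Real.sqrt n *
        ∫ x, (steepCut (a - h) ℓ (x + Real.log n) - steepCut (a - h) ℓ x) ^ 2 *
          (‖u (x + Real.log n)‖ * ‖u x‖) ≤ Sa * (2 * K * BF) := by
    have hterm : ∀ n ∈ weilPrimeIndex a,
        (ArithmeticFunction.vonMangoldt n : ℝ) / Real.sqrt n *
          ∫ x, (steepCut (a - h) ℓ (x + Real.log n) - steepCut (a - h) ℓ x) ^ 2 *
            (‖u (x + Real.log n)‖ * ‖u x‖) ≤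
        (ArithmeticFunction.vonMangoldt n : ℝ) / Real.sqrt n * (2 * K * BF) := by
      intro n _
      refine mul_le_mul_of_nonneg_left ?_
        (div_nonneg ArithmeticFunction.vonMangoldt_nonneg (Real.sqrt_nonneg _))
      calc _ ≤ 2 * K * ∫ x, f x :=
            stub_commutatorBound_prime_le hχ01 hχ1 hK hf0 hfb hfi (Real.log n)
        _ ≤ 2 * K * BF := mul_le_mul_of_nonneg_left hintf (by positivity)
    calc _ ≤ ∑ n ∈ weilPrimeIndex a, (ArithmeticFunction.vonMangoldt n : ℝ) / Real.sqrt n *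
          (2 * K * BF) := Finset.sum_le_sum hterm
      _ = Sa * (2 * K * BF) := by rw [hSadef, Finset.sum_mul]
  -- (3) the pole pairings
  have hwc : ∀ x, |x| ≤ a → |Real.cosh (x / 2)| ≤ M :=
    fun x hx ↦ (stub_commutatorBound_cosh_sinh_le le_rfl hx).1
  have hws : ∀ x, |x| ≤ a → |Real.sinh (x / 2)| ≤ M :=
    fun x hx ↦ (stub_commutatorBound_cosh_sinh_le le_rfl hx).2
  have hθ1 : ∀ x, |1 - steepCut (a - h) ℓ x| ≤ 1 :=
    fun x ↦ abs_le.2 ⟨by linarith [(hχ01 x).2], by linarith [(hχ01 x).1]⟩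
  have hθ2 : ∀ x, |(1 - steepCut (a - h) ℓ x) ^ 2| ≤ 1 := fun x ↦ by
    rw [abs_pow]
    calc |1 - steepCut (a - h) ℓ x| ^ 2 ≤ 1 ^ 2 := pow_le_pow_left₀ (abs_nonneg _) (hθ1 x) 2
      _ = 1 := one_pow 2
  have hθ10 : ∀ x, |x| ≤ a - 2 * ((h + ℓ) / 2) → 1 - steepCut (a - h) ℓ x = 0 :=
    fun x hx ↦ by rw [hχ1 x hx, sub_self]
  have hθ20 : ∀ x, |x| ≤ a - 2 * ((h + ℓ) / 2) → (1 - steepCut (a - h) ℓ x) ^ 2 = 0 :=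
    fun x hx ↦ by rw [hθ10 x hx]; norm_num
  have hP1 : ‖∫ t, ((1 - steepCut (a - h) ℓ t : ℝ) : ℂ) * u t * (Real.cosh (t / 2) : ℂ)‖ ≤
      M * BF :=
    (stub_commutatorBound_pole_le (θ := fun t ↦ 1 - steepCut (a - h) ℓ t)
      (w := fun t ↦ Real.cosh (t / 2)) hu0' hθ1 hθ10 hf0 hfb hfi hM hwc).trans
      (mul_le_mul_of_nonneg_left hintf hM)
  have hP2 : ‖∫ t, (((1 - steepCut (a - h) ℓ t) ^ 2 : ℝ) : ℂ) * u t * (Real.cosh (t / 2) : ℂ)‖ ≤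
      M * BF :=
    (stub_commutatorBound_pole_le (θ := fun t ↦ (1 - steepCut (a - h) ℓ t) ^ 2)
      (w := fun t ↦ Real.cosh (t / 2)) hu0' hθ2 hθ20 hf0 hfb hfi hM hwc).trans
      (mul_le_mul_of_nonneg_left hintf hM)
  have hP3 : ‖∫ t, (((1 - steepCut (a - h) ℓ t) ^ 2 : ℝ) : ℂ) * u t * (Real.sinh (t / 2) : ℂ)‖ ≤
      M * BF :=
    (stub_commutatorBound_pole_le (θ := fun t ↦ (1 - steepCut (a - h) ℓ t) ^ 2)
      (w := fun t ↦ Real.sinh (t / 2)) hu0' hθ2 hθ20 hf0 hfb hfi hM hws).trans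
      (mul_le_mul_of_nonneg_left hintf hM)
  have hQ1 : ‖∫ t, u t * (Real.cosh (t / 2) : ℂ)‖ ≤ M * (a + 1 / 2) :=
    (stub_commutatorBound_pairing_le (w := fun t ↦ Real.cosh (t / 2)) hu0' hui hwc).trans
      (mul_le_mul_of_nonneg_left hL1 hM)
  have hQ2 : ‖∫ t, u t * (Real.sinh (t / 2) : ℂ)‖ ≤ M * (a + 1 / 2) :=
    (stub_commutatorBound_pairing_le (w := fun t ↦ Real.sinh (t / 2)) hu0' hui hws).trans
      (mul_le_mul_of_nonneg_left hL1 hM)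
  have hT3 : 2 * ‖∫ t, ((1 - steepCut (a - h) ℓ t : ℝ) : ℂ) * u t * (Real.cosh (t / 2) : ℂ)‖ ^ 2 ≤
      2 * (M * BF) ^ 2 := by
    have := pow_le_pow_left₀ (norm_nonneg _) hP1 2
    linarith
  have hT4 : 2 * ‖∫ t, u t * (Real.cosh (t / 2) : ℂ)‖ *
        ‖∫ t, (((1 - steepCut (a - h) ℓ t) ^ 2 : ℝ) : ℂ) * u t * (Real.cosh (t / 2) : ℂ)‖ ≤
      2 * (M * (a + 1 / 2)) * (M * BF) :=
    mul_le_mul (mul_le_mul_of_nonneg_left hQ1 zero_le_two) hP2 (norm_nonneg _) (by positivity)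
  have hT5 : 2 * ‖∫ t, u t * (Real.sinh (t / 2) : ℂ)‖ *
        ‖∫ t, (((1 - steepCut (a - h) ℓ t) ^ 2 : ℝ) : ℂ) * u t * (Real.sinh (t / 2) : ℂ)‖ ≤
      2 * (M * (a + 1 / 2)) * (M * BF) :=
    mul_le_mul (mul_le_mul_of_nonneg_left hQ2 zero_le_two) hP3 (norm_nonneg _) (by positivity)
  -- (4) the mass of the cut state
  have hmass : 1 - I' * (h + ℓ) / Real.log (1 / (h + ℓ)) ≤
      ∫ x, ‖(steepCut (a - h) ℓ x : ℂ) * u x‖ ^ 2 := by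
    have h1 := stub_commutatorBound_mass_ge hu.memLp.1 hu2 (continuous_steepCut hℓ) hχ01 hχ1
    rw [hnorm] at h1
    have h2 : ∫ x in {x : ℝ | a - 2 * ((h + ℓ) / 2) < |x|}, ‖u x‖ ^ 2 ≤
        I' * (h + ℓ) / Real.log (1 / (h + ℓ)) := by
      have : (2 : ℝ) * ((h + ℓ) / 2) = h + ℓ := by ring
      rw [this]
      exact hmH
    linarith
  -- assembly
  have hΔ : 0 ≤ weilGroundEnergy (a - h) - weilGroundEnergy a :=
    sub_nonneg.2 (windowLipschitz_antitone hb hba)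
  have hlhs : (weilGroundEnergy (a - h) - weilGroundEnergy a) *
        (1 - I' * (h + ℓ) / Real.log (1 / (h + ℓ))) ≤
      (weilGroundEnergy (a - h) - weilGroundEnergy a) *
        ∫ x, ‖(steepCut (a - h) ℓ x : ℂ) * u x‖ ^ 2 := mul_le_mul_of_nonneg_left hmass hΔ
  have hsum := add_le_add (add_le_add (add_le_add (add_le_add hT1 hT2) hT3) hT4) hT5
  calc _ ≤ _ := hlhs
    _ ≤ _ := hD
    _ ≤ _ := hsum
    _ = _ := by ring

/-- `L ≤ log(1/x)` when `0 < x ≤ e^{−L}`. -/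
theorem le_log_one_div_of_le_exp_neg {x L : ℝ} (hx : 0 < x) (hxL : x ≤ Real.exp (-L)) :
    L ≤ Real.log (1 / x) := by
  rw [Real.le_log_iff_exp_le (by positivity), le_div_iff₀ hx]
  calc Real.exp L * x ≤ Real.exp L * Real.exp (-L) :=
        mul_le_mul_of_nonneg_left hxL (Real.exp_pos _).le
    _ = 1 := by rw [← Real.exp_add, add_neg_cancel, Real.exp_zero]

/-- The final bookkeeping of the upper edge law: if `Δ ≥ 0`, `Δ(1 − μ) ≤ (I + δ/2)h` with a mass
defect `0 ≤ μ ≤ m ≤ 1/2`, `2m(2I + δ) ≤ δ`, then `Δ ≤ (I + δ)h`. -/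
theorem edgeUpper_of_massDefect {Δ μ m I δ h : ℝ} (hΔ : 0 ≤ Δ) (hμ0 : 0 ≤ μ) (hμm : μ ≤ m)
    (hm2 : m ≤ 1 / 2) (hmδ : m * (2 * (2 * I + δ)) ≤ δ) (hh : 0 < h)
    (hmain : Δ * (1 - μ) ≤ (I + δ / 2) * h) : Δ ≤ (I + δ) * h := by
  have hm0 : 0 ≤ m := hμ0.trans hμm
  have h1 : 0 ≤ Δ * (1 / 2 - μ) := mul_nonneg hΔ (by linarith)
  have h2 : Δ ≤ (2 * I + δ) * h := by linarith
  have h3 : Δ * μ ≤ Δ * m := mul_le_mul_of_nonneg_left hμm hΔ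
  have h4 : Δ * m ≤ (2 * I + δ) * h * m := mul_le_mul_of_nonneg_right h2 hm0
  have h5 : h / 2 * (m * (2 * (2 * I + δ))) ≤ h / 2 * δ :=
    mul_le_mul_of_nonneg_left hmδ (by positivity)
  linarith

set_option maxHeartbeats 800000 in
/-- **The error terms are `O(h/√log(1/(κh)))`.** For `0 < η`, `κ ≥ 2(1 + η)`, `0 < r₀`
there is `C ≥ 0` with
`cutArchErr a h (ηh) (κh) r₀ K_P I + cutPrimePoleErr a h (ηh) K I ≤ C · h/√log(1/(κh))`
for all `0 < h ≤ 1` with `κh ≤ e^{−1}`. -/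
theorem cutErr_le {a η κ r₀ K KP I : ℝ} (ha : 0 < a) (hη : 0 < η)
    (hκ : 2 * (1 + η) ≤ κ) (hr0 : 0 < r₀) (hK : 0 ≤ K) (hKP : 0 ≤ KP) (hI : 0 ≤ I) :
    ∃ C : ℝ, 0 ≤ C ∧ ∀ h : ℝ, 0 < h → h ≤ 1 → κ * h ≤ Real.exp (-1) →
      cutArchErr a h (η * h) (κ * h) r₀ KP I + cutPrimePoleErr a h (η * h) K I ≤
        C * h / Real.sqrt (Real.log (1 / (κ * h))) := by
  unfold cutArchErr cutPrimePoleErr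
  have hκ0 : 0 < κ := by linarith
  -- the constants
  set P : ℝ := cutFarWeight r₀ + I / (2 * Real.sqrt (Real.log (1 / r₀))) with hPdef
  have hP0 : 0 ≤ P := by
    have := cutFarWeight_nonneg hr0
    positivity
  set ρ₂ : ℝ := weilArchDensity (r₀ / 2) with hρ₂def
  have hρ₂ : 0 < ρ₂ := weilArchDensity_pos (by positivity)
  set M : ℝ := Real.cosh (a / 2) with hMdef
  set Sa : ℝ := ∑ n ∈ weilPrimeIndex a, (ArithmeticFunction.vonMangoldt n : ℝ) / Real.sqrt n
    with hSadef
  have hSa0 : 0 ≤ Sa :=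
    Finset.sum_nonneg fun n _ ↦ div_nonneg ArithmeticFunction.vonMangoldt_nonneg (Real.sqrt_nonneg _)
  set b₁ : ℝ := (1 + I / 2) * (1 + η) with hb₁def
  have hb₁0 : 0 ≤ b₁ := by positivity
  have hlog0 : 0 ≤ Real.log ((κ + η) / η) :=
    Real.log_nonneg (by rw [le_div_iff₀ hη]; linarith)
  set C : ℝ := (1 + η) * P + 4 * (1 + η) * KP * (Real.log ((κ + η) / η) + κ) +
    2 * (1 + ρ₂) * (a + 1 / 2) * b₁ + (2 * K * Sa + 4 * M ^ 2 * (a + 1 / 2) + 2 * M ^ 2 * b₁) * b₁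
    with hCdef
  have hC0 : 0 ≤ C := by positivity
  refine ⟨C, hC0, fun h hh hh1 hκe ↦ ?_⟩
  -- the two scales
  have hHeq : h + η * h = (1 + η) * h := by ring
  have hH : 0 < h + η * h := by positivity
  have hHκ : h + η * h ≤ κ * h := by rw [hHeq]; exact mul_le_mul_of_nonneg_right (by linarith) hh.le
  have hκh0 : 0 < κ * h := by positivity
  have hLR1 : 1 ≤ Real.log (1 / (κ * h)) := le_log_one_div_of_le_exp_neg hκh0 hκe
  have hLR : 0 < Real.log (1 / (κ * h)) := by linarith
  have hLHR : Real.log (1 / (κ * h)) ≤ Real.log (1 / (h + η * h)) := log_one_div_antitone hH hHκ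
  have hLH1 : 1 ≤ Real.log (1 / (h + η * h)) := hLR1.trans hLHR
  have hLH : 0 < Real.log (1 / (h + η * h)) := by linarith
  set sH := Real.sqrt (Real.log (1 / (h + η * h))) with hsHdef
  set sR := Real.sqrt (Real.log (1 / (κ * h))) with hsRdef
  have hsR1 : 1 ≤ sR := Real.one_le_sqrt.2 hLR1
  have hsH1 : 1 ≤ sH := Real.one_le_sqrt.2 hLH1
  have hsR : 0 < sR := by linarith
  have hsH : 0 < sH := by linarith
  have hsRH : sR ≤ sH := Real.sqrt_le_sqrt hLHR
  have hφ : h / sH ≤ h / sR := div_le_div_of_nonneg_left hh.le hsR hsRH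
  have hφ1 : h / sH ≤ 1 := (div_le_self hh.le hsH1).trans hh1
  have hφ0 : 0 ≤ h / sR := by positivity
  have hφ0' : 0 ≤ h / sH := by positivity
  -- `θ ≤ 2`
  have hden : 0 < κ * h - (h + η * h) := by
    rw [hHeq]
    have : (1 + η) * h < κ * h := mul_lt_mul_of_pos_right (by linarith) hh
    linarith
  have hθ0 : 0 ≤ κ * h / (κ * h - (h + η * h)) := div_nonneg hκh0.le hden.le
  have hθ2 : κ * h / (κ * h - (h + η * h)) ≤ 2 := by
    rw [div_le_iff₀ hden, hHeq]
    have : 2 * (1 + η) * h ≤ κ * h := mul_le_mul_of_nonneg_right hκ hh.le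
    linarith
  -- E1
  have hE1 : κ * h / (κ * h - (h + η * h)) * (h + η * h) / (2 * sH) * P ≤ (1 + η) * P * (h / sR) := by
    have h1 : κ * h / (κ * h - (h + η * h)) * (h + η * h) / (2 * sH) * P =
        κ * h / (κ * h - (h + η * h)) / 2 * ((1 + η) * P) * (h / sH) := by
      rw [hHeq]
      ring
    rw [h1]
    calc _ ≤ 2 / 2 * ((1 + η) * P) * (h / sR) :=
          mul_le_mul (mul_le_mul_of_nonneg_right (by linarith) (by positivity)) hφ hφ0'
            (by positivity)
      _ = (1 + η) * P * (h / sR) := by ring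
  -- E2
  have hE2 : 4 * (h + η * h) * KP * (Real.log ((κ * h + η * h) / (η * h)) + κ * h) /
        Real.sqrt (Real.log (1 / (h + η * h)) * Real.log (1 / (κ * h))) ≤
      4 * (1 + η) * KP * (Real.log ((κ + η) / η) + κ) * (h / sR) := by
    have hq : (κ * h + η * h) / (η * h) = (κ + η) / η := by
      rw [div_eq_div_iff (by positivity) (by positivity)]
      ring
    rw [hq, Real.sqrt_mul hLH.le]
    have h1 : Real.log ((κ + η) / η) + κ * h ≤ Real.log ((κ + η) / η) + κ := by
      have : κ * h ≤ κ * 1 := mul_le_mul_of_nonneg_left hh1 hκ0.le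
      linarith
    have h2 : 4 * (h + η * h) * KP * (Real.log ((κ + η) / η) + κ * h) / (sH * sR) =
        4 * (1 + η) * KP * (Real.log ((κ + η) / η) + κ * h) * ((h / sR) / sH) := by
      rw [hHeq]
      field_simp
    rw [h2]
    have h3 : (h / sR) / sH ≤ h / sR := div_le_self hφ0 hsH1
    have h4 : 0 ≤ Real.log ((κ + η) / η) + κ * h := by positivity
    exact mul_le_mul (mul_le_mul_of_nonneg_left h1 (by positivity)) h3 (by positivity)
      (by positivity)
  -- E3 and the layer norm
  have hBF : (1 + I / 2) * (h + η * h) / sH = b₁ * (h / sH) := by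
    rw [hHeq, hb₁def]
    ring
  have hE3 : 2 * (1 + ρ₂) * (a + 1 / 2) * ((1 + I / 2) * (h + η * h) / sH) ≤
      2 * (1 + ρ₂) * (a + 1 / 2) * b₁ * (h / sR) := by
    rw [hBF]
    calc _ = 2 * (1 + ρ₂) * (a + 1 / 2) * b₁ * (h / sH) := by ring
      _ ≤ _ := mul_le_mul_of_nonneg_left hφ (by positivity)
  have hBF1 : (1 + I / 2) * (h + η * h) / sH ≤ b₁ := by
    rw [hBF]
    calc b₁ * (h / sH) ≤ b₁ * 1 := mul_le_mul_of_nonneg_left hφ1 hb₁0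
      _ = b₁ := mul_one _
  have hBF2 : (1 + I / 2) * (h + η * h) / sH ≤ b₁ * (h / sR) := by
    rw [hBF]
    exact mul_le_mul_of_nonneg_left hφ hb₁0
  have hBF0 : 0 ≤ (1 + I / 2) * (h + η * h) / sH := by positivity
  have hPP : (2 * K * Sa + 4 * M ^ 2 * (a + 1 / 2) +
        2 * M ^ 2 * ((1 + I / 2) * (h + η * h) / sH)) * ((1 + I / 2) * (h + η * h) / sH) ≤
      (2 * K * Sa + 4 * M ^ 2 * (a + 1 / 2) + 2 * M ^ 2 * b₁) * (b₁ * (h / sR)) := by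
    have h1 : 2 * M ^ 2 * ((1 + I / 2) * (h + η * h) / sH) ≤ 2 * M ^ 2 * b₁ :=
      mul_le_mul_of_nonneg_left hBF1 (by positivity)
    exact mul_le_mul (by linarith) hBF2 hBF0 (by positivity)
  -- sum
  calc _ ≤ C * (h / sR) := by
        rw [hCdef]
        linarith [hE1, hE2, hE3, hPP]
    _ = C * h / sR := (mul_div_assoc _ _ _).symm

end Summit.RiemannHypothesis.RiemannHypothesis.Theorems.PfPersistence

end
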